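import Summits.ResolutionOfSingularities.ResolutionOfSingularities.Theorems.FrobeniusClosingPatchingRelPerfectConeDepthSmoothConeRung
import Summits.ResolutionOfSingularities.ResolutionOfSingularities.Theorems.FrobeniusClosingPatchingRelPerfectConeDepthSmoothQuadricDisc
import HarnessLib

/-!
# Crux `PatchingRelPerfect` (stmt-ResolutionOfSingularities-16161), chain W5.2 — RUNG «r-fermat-cone-ℓ» BY NAME: the FERMAT cones
# `x₀^d + x₁^d + x₂^d` of EVERY degree `d ≥ 2` with `d ∈ S×`, at every exceptional depth

[OURS · L1 W5.2 · rung tool] Replaces the role of NO printed item; NOT a statement of the manuscript under review; fact-free,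
any residue characteristic not dividing `d`, no completeness, no coefficient field.  AI-written (AI review is weaker than expert review).

`S` regular local of dimension `4` with `d ≥ 2`, `d ∈ S×`, `x₀, …, x₃` a regular system of parameters, `q = x₀^d + x₁^d + x₂^d` — the
cone over the smooth Fermat curve of degree `d` (cubic cones for `d = 3`, …): `(q) + 𝔪^{ℓ+d} ∈ 𝒞` for EVERY `ℓ` with the blow-up-form
core conclusion (`fermatConeRung_of_ringKrullDim`, core dress `atomDimFourBlowupAt_fermatCone`), an instance of
`smoothConeRung_of_ringKrullDim` of arbitrary degree: (HV) because `T_k^{d-1} = d̄⁻¹ ∂_kF₀` puts `(T₁,T₂,T₃)` inside the radical of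
`(F₀, ∂F₀)` (`Ideal.exists_pow_le_of_le_radical_of_fg`); (HC) because `d·F_i − Σ_k T_k ∂_kF_i = d` is a unit.  First cones of
degree `> 2` at every depth in the rung ledger.

## References
* J. Kollár, *Lectures on Resolution of Singularities* (2007), 3.61, (3.111) Step 3. [Kollar2007]
* H. Matsumura, *Commutative Ring Theory*, CUP 1986, Thm. 30.3. [Matsumura1987]
* The Stacks Project, Tag 080A. [StacksProject]
-/

set_option linter.dupNamespace false

noncomputable section

open CategoryTheory CategoryTheory.Limits AlgebraicGeometry TopologicalSpace IsLocalRing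
open Literature.AlgebraicGeometry.Resolution
open Scheme.IdealSheafData
open scoped Pointwise

namespace Summit.ResolutionOfSingularities.ResolutionOfSingularities.Theorems

universe u

namespace ConeDepth

/-! ## The Fermat form and its certificates -/

section FermatForm

variable {S : Type u} [CommRing S] (n : ℕ)

/-- `U₀^{n+1} + U₁^{n+1} + U₂^{n+1}` is a form of degree `n + 1`. [folklore] -/
theorem isHomogeneous_fermatForm :
    (MvPolynomial.X 0 ^ (n + 1) + MvPolynomial.X 1 ^ (n + 1) + MvPolynomial.X 2 ^ (n + 1) :
      MvPolynomial (Fin 3) S).IsHomogeneous (n + 1) := by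
  have hX : ∀ j : Fin 3, (MvPolynomial.X j ^ (n + 1) : MvPolynomial (Fin 3) S).IsHomogeneous (n + 1) := fun j => by
    simpa using (MvPolynomial.isHomogeneous_X S j).pow (n + 1)
  exact ((hX 0).add (hX 1)).add (hX 2)

/-- `N(x₀,x₁,x₂) = x₀^{n+1} + x₁^{n+1} + x₂^{n+1}`. [folklore] -/
theorem eval_fermatForm (x : Fin 4 → S) :
    MvPolynomial.eval (fun k : Fin 3 => x k.castSucc)
      (MvPolynomial.X 0 ^ (n + 1) + MvPolynomial.X 1 ^ (n + 1) + MvPolynomial.X 2 ^ (n + 1) : MvPolynomial (Fin 3) S) =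
      x 0 ^ (n + 1) + x 1 ^ (n + 1) + x 2 ^ (n + 1) := by
  have h0 : (Fin.castSucc (0 : Fin 3) : Fin 4) = 0 := rfl
  have h1 : (Fin.castSucc (1 : Fin 3) : Fin 4) = 1 := rfl
  have h2 : (Fin.castSucc (2 : Fin 3) : Fin 4) = 2 := rfl
  simp only [map_add, map_pow, MvPolynomial.eval_X, h0, h1, h2]

variable [IsLocalRing S]

/-- The reduced chart polynomials of the Fermat form. [folklore] -/
theorem chartPoly_fermatForm (i : Fin 4) :
    chartPoly (MvPolynomial.rename Fin.succ
      (MvPolynomial.X 0 ^ (n + 1) + MvPolynomial.X 1 ^ (n + 1) + MvPolynomial.X 2 ^ (n + 1) : MvPolynomial (Fin 3) S)) i =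
      killVar i 1 ^ (n + 1) + killVar i 2 ^ (n + 1) + killVar i 3 ^ (n + 1) := by
  have h0 : (Fin.succ (0 : Fin 3) : Fin 4) = 1 := rfl
  have h1 : (Fin.succ (1 : Fin 3) : Fin 4) = 2 := rfl
  have h2 : (Fin.succ (2 : Fin 3) : Fin 4) = 3 := rfl
  rw [chartPoly_rename_succ]
  simp only [map_add, map_pow, MvPolynomial.map_X, MvPolynomial.aeval_X, h0, h1, h2]

omit [IsLocalRing S] in
/-- `∂(T_t^{n+1})/∂T_t = (n+1) T_t^n`. [folklore] -/
theorem pderiv_X_pow_self {σ : Type*} {K : Type u} [CommRing K] (t : σ) :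
    MvPolynomial.pderiv t ((MvPolynomial.X t : MvPolynomial σ K) ^ (n + 1)) =
      ((n + 1 : ℕ) : MvPolynomial σ K) * MvPolynomial.X t ^ n := by
  classical
  rw [Derivation.leibniz_pow, MvPolynomial.pderiv_X, Pi.single_eq_same, smul_eq_mul, mul_one, nsmul_eq_mul, Nat.add_sub_cancel]

omit [IsLocalRing S] in
/-- `∂(T_s^{n+1})/∂T_t = 0` for `s ≠ t`. [folklore] -/
theorem pderiv_X_pow_of_ne {σ : Type*} {K : Type u} [CommRing K] {s t : σ} (h : s ≠ t) :
    MvPolynomial.pderiv t ((MvPolynomial.X s : MvPolynomial σ K) ^ (n + 1)) = 0 := by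
  classical
  rw [Derivation.leibniz_pow, MvPolynomial.pderiv_X, Pi.single_eq_of_ne h, smul_zero, smul_zero]

omit [IsLocalRing S] in
/-- The three variables of the vertex chart. [folklore] -/
theorem eq_one_or_two_or_three (t : {j : Fin 4 // j ≠ (0 : Fin 4)}) :
    t = ⟨1, by decide⟩ ∨ t = ⟨2, by decide⟩ ∨ t = ⟨3, by decide⟩ := by
  obtain ⟨k, hk⟩ := t
  fin_cases k
  · exact absurd rfl hk
  · exact Or.inl rfl
  · exact Or.inr (Or.inl rfl)
  · exact Or.inr (Or.inr rfl)

/-- **(HV) for the Fermat cone**: `T_k^n = (n+1)⁻¹ ∂_kF₀`, so `(T₁,T₂,T₃) ≤ √(F₀, ∂F₀)` and some power lies inside.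
[cite: Matsumura1987, Thm. 30.3] -/
theorem fermatForm_HV (hd : IsUnit ((n + 1 : ℕ) : S)) :
    ∃ m : ℕ, Ideal.span (Set.range (MvPolynomial.X : {j : Fin 4 // j ≠ (0 : Fin 4)} → _)) ^ m ≤
      Ideal.span (insert (chartPoly (MvPolynomial.rename Fin.succ
        (MvPolynomial.X 0 ^ (n + 1) + MvPolynomial.X 1 ^ (n + 1) + MvPolynomial.X 2 ^ (n + 1) : MvPolynomial (Fin 3) S)) 0)
        (Set.range fun t => MvPolynomial.pderiv t (chartPoly (MvPolynomial.rename Fin.succ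
          (MvPolynomial.X 0 ^ (n + 1) + MvPolynomial.X 1 ^ (n + 1) + MvPolynomial.X 2 ^ (n + 1) : MvPolynomial (Fin 3) S)) 0))) := by
  classical
  have hd' : ((n + 1 : ℕ) : ResidueField S) ≠ 0 := by
    have h := (hd.map (residue S)).ne_zero; rwa [map_natCast] at h
  rw [chartPoly_fermatForm, killVar_of_ne 0 1 (by decide), killVar_of_ne 0 2 (by decide), killVar_of_ne 0 3 (by decide)]
  set F : MvPolynomial {j : Fin 4 // j ≠ (0 : Fin 4)} (ResidueField S) :=
    MvPolynomial.X ⟨1, by decide⟩ ^ (n + 1) + MvPolynomial.X ⟨2, by decide⟩ ^ (n + 1) + MvPolynomial.X ⟨3, by decide⟩ ^ (n + 1)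
    with hF
  set I := Ideal.span (insert F (Set.range fun t => MvPolynomial.pderiv t F)) with hI
  have hdF : ∀ t, MvPolynomial.pderiv t F ∈ I := fun t => Ideal.subset_span (Set.mem_insert_of_mem _ (Set.mem_range_self t))
  have h12 : (⟨1, by decide⟩ : {j : Fin 4 // j ≠ (0 : Fin 4)}) ≠ ⟨2, by decide⟩ := by decide
  have h13 : (⟨1, by decide⟩ : {j : Fin 4 // j ≠ (0 : Fin 4)}) ≠ ⟨3, by decide⟩ := by decide
  have h23 : (⟨2, by decide⟩ : {j : Fin 4 // j ≠ (0 : Fin 4)}) ≠ ⟨3, by decide⟩ := by decide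
  -- `∂_t F = (n+1) T_t^n` for every variable `t`
  have hpd : ∀ t : {j : Fin 4 // j ≠ (0 : Fin 4)},
      MvPolynomial.pderiv t F = ((n + 1 : ℕ) : MvPolynomial _ (ResidueField S)) * MvPolynomial.X t ^ n := by
    intro t
    rw [hF, map_add, map_add]
    rcases eq_one_or_two_or_three t with rfl | rfl | rfl
    · rw [pderiv_X_pow_self, pderiv_X_pow_of_ne n h12.symm, pderiv_X_pow_of_ne n h13.symm, add_zero, add_zero]
    · rw [pderiv_X_pow_of_ne n h12, pderiv_X_pow_self, pderiv_X_pow_of_ne n h23.symm, zero_add, add_zero]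
    · rw [pderiv_X_pow_of_ne n h13, pderiv_X_pow_of_ne n h23, pderiv_X_pow_self, zero_add, zero_add]
  have hrad : Ideal.span (Set.range (MvPolynomial.X : {j : Fin 4 // j ≠ (0 : Fin 4)} → _)) ≤ I.radical := by
    rw [Ideal.span_le]
    rintro _ ⟨t, rfl⟩
    refine ⟨n, ?_⟩
    have heq : (MvPolynomial.X t : MvPolynomial {j : Fin 4 // j ≠ (0 : Fin 4)} (ResidueField S)) ^ n =
        MvPolynomial.C ((n + 1 : ℕ) : ResidueField S)⁻¹ * MvPolynomial.pderiv t F := by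
      rw [hpd, ← map_natCast MvPolynomial.C, ← mul_assoc, ← map_mul, inv_mul_cancel₀ hd', map_one, one_mul]
    rw [heq]
    exact I.mul_mem_left _ (hdF t)
  exact Ideal.exists_pow_le_of_le_radical_of_fg hrad (Submodule.fg_span (Set.finite_range _))

/-- (HC) on a chart `T_i = 1`, `i ≠ 0`, for the Fermat form: with the two surviving variables `u, v`,
`(n+1)·F − u ∂_uF − v ∂_vF = n+1`. [cite: Matsumura1987, Thm. 30.3] -/
theorem fermatForm_HC_of (hd : IsUnit ((n + 1 : ℕ) : S)) (i : Fin 4) (u v : {j : Fin 4 // j ≠ i}) (huv : u ≠ v)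
    (hF : chartPoly (MvPolynomial.rename Fin.succ
      (MvPolynomial.X 0 ^ (n + 1) + MvPolynomial.X 1 ^ (n + 1) + MvPolynomial.X 2 ^ (n + 1) : MvPolynomial (Fin 3) S)) i =
      1 + MvPolynomial.X u ^ (n + 1) + MvPolynomial.X v ^ (n + 1)) :
    Ideal.span (insert (chartPoly (MvPolynomial.rename Fin.succ
      (MvPolynomial.X 0 ^ (n + 1) + MvPolynomial.X 1 ^ (n + 1) + MvPolynomial.X 2 ^ (n + 1) : MvPolynomial (Fin 3) S)) i)
      (Set.range fun t => MvPolynomial.pderiv t (chartPoly (MvPolynomial.rename Fin.succ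
        (MvPolynomial.X 0 ^ (n + 1) + MvPolynomial.X 1 ^ (n + 1) + MvPolynomial.X 2 ^ (n + 1) : MvPolynomial (Fin 3) S)) i))) = ⊤ := by
  classical
  have hd' : ((n + 1 : ℕ) : ResidueField S) ≠ 0 := by
    have h := (hd.map (residue S)).ne_zero; rwa [map_natCast] at h
  rw [hF]
  set F : MvPolynomial {j : Fin 4 // j ≠ i} (ResidueField S) := 1 + MvPolynomial.X u ^ (n + 1) + MvPolynomial.X v ^ (n + 1)
    with hFdef
  set I := Ideal.span (insert F (Set.range fun t => MvPolynomial.pderiv t F)) with hI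
  have hFI : F ∈ I := Ideal.subset_span (Set.mem_insert _ _)
  have hdF : ∀ t, MvPolynomial.pderiv t F ∈ I := fun t => Ideal.subset_span (Set.mem_insert_of_mem _ (Set.mem_range_self t))
  have hpu : MvPolynomial.pderiv u F = ((n + 1 : ℕ) : MvPolynomial _ (ResidueField S)) * MvPolynomial.X u ^ n := by
    rw [hFdef, map_add, map_add, Derivation.map_one_eq_zero, zero_add, pderiv_X_pow_self, pderiv_X_pow_of_ne n (Ne.symm huv),
      add_zero]
  have hpv : MvPolynomial.pderiv v F = ((n + 1 : ℕ) : MvPolynomial _ (ResidueField S)) * MvPolynomial.X v ^ n := by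
    rw [hFdef, map_add, map_add, Derivation.map_one_eq_zero, zero_add, pderiv_X_pow_of_ne n huv, pderiv_X_pow_self, zero_add]
  have hmem : MvPolynomial.C ((n + 1 : ℕ) : ResidueField S) * F - MvPolynomial.X u * MvPolynomial.pderiv u F -
      MvPolynomial.X v * MvPolynomial.pderiv v F ∈ I :=
    I.sub_mem (I.sub_mem (I.mul_mem_left _ hFI) (I.mul_mem_left _ (hdF _))) (I.mul_mem_left _ (hdF _))
  refine ideal_eq_top_of_mem_of_eq_C hmem ?_ hd'
  rw [hpu, hpv, hFdef, map_natCast]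
  ring

/-- **(HC) for the Fermat cone** on every chart `i ≠ 0`. [cite: Matsumura1987, Thm. 30.3] -/
theorem fermatForm_HC (hd : IsUnit ((n + 1 : ℕ) : S)) (i : Fin 4) (hi : i ≠ 0) :
    Ideal.span (insert (chartPoly (MvPolynomial.rename Fin.succ
      (MvPolynomial.X 0 ^ (n + 1) + MvPolynomial.X 1 ^ (n + 1) + MvPolynomial.X 2 ^ (n + 1) : MvPolynomial (Fin 3) S)) i)
      (Set.range fun t => MvPolynomial.pderiv t (chartPoly (MvPolynomial.rename Fin.succ
        (MvPolynomial.X 0 ^ (n + 1) + MvPolynomial.X 1 ^ (n + 1) + MvPolynomial.X 2 ^ (n + 1) : MvPolynomial (Fin 3) S)) i))) = ⊤ := by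
  have h1 := fermatForm_HC_of (S := S) n hd 1 ⟨2, by decide⟩ ⟨3, by decide⟩ (by decide)
    (by rw [chartPoly_fermatForm, killVar_self, killVar_of_ne 1 2 (by decide), killVar_of_ne 1 3 (by decide), one_pow])
  have h2 := fermatForm_HC_of (S := S) n hd 2 ⟨1, by decide⟩ ⟨3, by decide⟩ (by decide)
    (by rw [chartPoly_fermatForm, killVar_self, killVar_of_ne 2 1 (by decide), killVar_of_ne 2 3 (by decide), one_pow]; ring)
  have h3 := fermatForm_HC_of (S := S) n hd 3 ⟨1, by decide⟩ ⟨2, by decide⟩ (by decide)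
    (by rw [chartPoly_fermatForm, killVar_self, killVar_of_ne 3 1 (by decide), killVar_of_ne 3 2 (by decide), one_pow]; ring)
  fin_cases i
  · exact absurd rfl hi
  · exact h1
  · exact h2
  · exact h3

end FermatForm

/-! ## The rung «r-fermat-cone-ℓ» -/

section FermatRung

variable {S : Type u} [CommRing S] [IsRegularLocalRing S]
  (x : Fin 4 → S) (hx : Ideal.span (Set.range x) = maximalIdeal S) (hdim : ringKrullDim S = (4 : ℕ))
  (n : ℕ) (hn : 1 ≤ n) (hd : IsUnit ((n + 1 : ℕ) : S)) (ℓ : ℕ)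

include hx hdim hn hd in
/-- **RUNG «r-fermat-cone-ℓ», UNCONDITIONAL PACKAGE**: for `S` regular local of dimension `4`, `x` spanning `𝔪`, a degree
`d = n + 1 ≥ 2` invertible in `S`, `q = x₀^d + x₁^d + x₂^d` and EVERY `ℓ`: (1) `(q) + 𝔪^{ℓ+d} ∈ 𝒞`; (2) the blow-up-form core
conclusion for every `T = Bl_I Spec S`, `I = (q) + 𝔪^{ℓ+d}`.  Cones of EVERY degree at every depth (cubic cones at `d = 3`, …);
fact-free. [cite: Kollar2007, 3.61 and (3.111) Step 3] [cite: StacksProject, Tag 080A] -/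
theorem fermatConeRung_of_ringKrullDim :
    (∃ (Q : Ideal S) (m : ℕ), IsLocalRing.maximalIdeal S ^ m ≤ Q ∧
      ∃ (B' : Scheme.{u}) (b : B' ⟶ Spec (.of S)),
        IsBlowup b (affineBlowup.idealSheaf
          ((Ideal.span {x 0 ^ (n + 1) + x 1 ^ (n + 1) + x 2 ^ (n + 1)} ⊔ maximalIdeal S ^ (ℓ + (n + 1))) * Q)) ∧
        Scheme.IsRegular B') ∧
    (∀ (T : Scheme.{u}) (f : T ⟶ Spec (.of S)),
      IsBlowup f (affineBlowup.idealSheaf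
        (Ideal.span {x 0 ^ (n + 1) + x 1 ^ (n + 1) + x 2 ^ (n + 1)} ⊔ maximalIdeal S ^ (ℓ + (n + 1)))) →
      ∃ (J : T.IdealSheafData) (T' : Scheme.{u}) (π : T' ⟶ T), J ≠ ⊥ ∧
        (∀ t : T, t ∈ J.support → f.base t = IsLocalRing.closedPoint S) ∧
        IsBlowup π J ∧ Scheme.IsRegular T') := by
  rw [← eval_fermatForm n x]
  exact smoothConeRung_of_ringKrullDim x hx hdim (n + 1) (by omega) _ (isHomogeneous_fermatForm n) (fermatForm_HV n hd)
    (fermatForm_HC n hd) ℓ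

end FermatRung

/-- **The registered core's binder shape on the member `(x₀^d + x₁^d + x₂^d) + 𝔪^{ℓ+d}`**, `d = n + 1 ≥ 2` invertible in `S`
(hypotheses of `stub_atomDimFourBlowup`; completeness, perfectness and the off-fibre hypothesis unused). [cite: Kollar2007, 3.61] -/
theorem atomDimFourBlowupAt_fermatCone (p : ℕ) (_hp : p.Prime) (S : Type) [CommRing S]
    [IsRegularLocalRing S] [CharP S p] [IsAdicComplete (IsLocalRing.maximalIdeal S) S]
    [PerfectField (IsLocalRing.ResidueField S)] (hS : ringKrullDim S = (4 : ℕ))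
    (x : Fin 4 → S) (hx : Ideal.span (Set.range x) = IsLocalRing.maximalIdeal S)
    (n : ℕ) (hn : 1 ≤ n) (hd : IsUnit ((n + 1 : ℕ) : S)) (ℓ : ℕ)
    (T : Scheme.{0}) (f : T ⟶ Spec (.of S))
    (hf : IsBlowup f (affineBlowup.idealSheaf
      (Ideal.span {x 0 ^ (n + 1) + x 1 ^ (n + 1) + x 2 ^ (n + 1)} ⊔ IsLocalRing.maximalIdeal S ^ (ℓ + (n + 1)))))
    (_hoff : ∀ t : T, f.base t ≠ IsLocalRing.closedPoint S → IsRegularLocalRing (T.presheaf.stalk t)) :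
    ∃ (J : T.IdealSheafData) (T' : Scheme.{0}) (π : T' ⟶ T), J ≠ ⊥ ∧
      (∀ t : T, t ∈ J.support → f.base t = IsLocalRing.closedPoint S) ∧
      IsBlowup π J ∧ Scheme.IsRegular T' :=
  (fermatConeRung_of_ringKrullDim x hx hS n hn hd ℓ).2 T f hf

end ConeDepth

end Summit.ResolutionOfSingularities.ResolutionOfSingularities.Theorems

end
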